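import Literature.Computability.Complexity.ScaledPCPVerifier
import Literature.Computability.Complexity.CodeFPBudgets
import Literature.Computability.Complexity.CodeFPModArith
import Literature.Computability.Complexity.CodeFPFinite
import Literature.Computability.Complexity.CodeFPStrings
import Literature.Computability.Complexity.CodeFPFieldSetup
import HarnessLib

/-!
# The parameters of the scaled PCP verifier are polynomial time (`CodeFP` programmes from `1ⁿ`)

Literature / complexity toolkit, first MACHINE-LAYER brick for the spec-level verifier
`ScaledPCP.verifier' M T` of `ScaledPCPVerifier.lean` (Babai–Fortnow–Lund 1991 / Babai–Fortnow–
Levin–Szegedy 1991, scaled to a fixed exponential-time machine `M` with time bound `T n`; its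
`completeness` and `soundness` are proved there). Its two maps `queries`, `decide` read off the input
length `n` the parameters `h` (base), `kt`, `kJ` (digits, through `Nat.log`), `m`, `K`, `d`, `D`,
the number of tests, the prime `p = pN n` (the least prime above `BN n`, a `Nat.find`), the block
length `b`, the tape length `kF n` and the coin count. This file computes all of them from `1ⁿ` in
the typed algebra `CodeFP` (`CodeFP.lean` ff.), under the two honest hypotheses on the time bound —
`T` is computed on codes (`CodeFP unE natE T`) and `T n ≤ 2^{c_T n + c_T}`:

* `natLogC` — `Nat.log b x` for binary `b`, `x` (a capped multiplication scan, budget `|bin x|`);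
* `hNC`, `S1NC`, `ktNC`, `kJNC`, `mNC`, `KNC`, `dNC`, `degBoundC`, `DNC`, `TtNC`, `NN'C`, `BNC`;
* the PRIME: `pN_eq_leastPrimeGt` (`pN n` is the least prime above `BN n`, the `leastPrimeGt` of
  `CodeFPFieldSetup.lean`, computed there on a UNARY bound by trial division under Bertrand's
  postulate), the polynomial size bound **`BN_le`** (`2 BN n + 2 ≤ c · (n+2)⁷`, which sizes the
  unary numeral of `BN n`), and **`pNC : CodeFP unE natE (pN M T)`**;
* `b0C`, `kFC` (`kF n = K + 1 + K + Tt · 2m + (2n + c_Q) m`, `nQry_CN`), `bNC`, **`coinsNC`**.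

Everything is proved; no machine beyond the typed combinators; no named fact. (Any verifier with
these parameters — in particular an `FP` programme for `PCPBits.queries`/`verdict` of
`AlgebraicPCPLayout.lean` run with the field `ZMod (pN n)` — can take its parameters from here.)

## References

* L. Babai, L. Fortnow, L. Levin, M. Szegedy, *Checking computations in polylogarithmic time*,
  STOC 1991, §5 (the verifier's parameters are polynomial in the input length) [BFLS1991].
* S. Arora, B. Barak, *Computational Complexity: A Modern Approach*, CUP 2009, §1.3 (polynomial time:
  arithmetic, bounded loops), Lemma A.31, §11.5 [AroraBarakCC2009].
* P. L. Chebyshev (Bertrand's postulate), through Mathlib `Nat.exists_prime_lt_and_le_two_mul`.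
-/

noncomputable section

open Polynomial

namespace Literature.Computability.Complexity

namespace ScaledPCP

open CodeFP Turing Tableau TableauCSP AlgebraicPCP _root_.Computability

attribute [local instance] Turing.FinTM2.kFin Turing.FinTM2.ΛFin Turing.FinTM2.σFin
  Turing.FinTM2.Γk₀Fin

/-! ### Logarithms to a computed base -/

/-- The state of the capped multiplication scan after `i` rounds: `(bʳ, r)` with `r = min i (log_b x)`. [folklore] -/
def logState (b x i : ℕ) : ℕ × ℕ := (b ^ min i (Nat.log b x), min i (Nat.log b x))

/-- One round of the scan. [folklore] -/
def logStep (b x : ℕ) (st : ℕ × ℕ) : ℕ × ℕ := if st.1 * b ≤ x then (st.1 * b, st.2 + 1) else st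

/-- The scan computes `logState` (base `≥ 2`). [folklore] -/
theorem foldl_logStep {b : ℕ} (hb : 2 ≤ b) (x : ℕ) (l : List Unit) : ∀ i : ℕ,
    l.foldl (fun st _ => logStep b x st) (logState b x i) = logState b x (i + l.length) := by
  induction l with
  | nil => intro i; simp
  | cons a l ih =>
    intro i
    rw [List.foldl_cons, List.length_cons, show i + (l.length + 1) = (i + 1) + l.length by omega, ← ih (i + 1)]
    congr 1
    simp only [logStep, logState]
    by_cases hi : i + 1 ≤ Nat.log b x
    · have hx : x ≠ 0 := by rintro rfl; simp at hi
      rw [min_eq_left (by omega : i ≤ Nat.log b x), min_eq_left hi, if_pos]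
      · rw [pow_succ]
      · rw [← pow_succ]
        exact Nat.pow_le_of_le_log hx hi
    · push Not at hi
      rw [min_eq_right (by omega : Nat.log b x ≤ i), min_eq_right (by omega : Nat.log b x ≤ i + 1), if_neg]
      rw [← pow_succ, not_le]
      exact Nat.lt_pow_succ_log_self hb x

/-- **Logarithm to a computed base, capped**: `((b, x), l) ↦ min |l| (log_b x)` for `b ≥ 2` (and `0`
for `b < 2`, as `Nat.log`). [cite: AroraBarakCC2009, §1.3] -/
theorem natLogMin : CodeFP (pairE (pairE natE natE) (rawE unitE)) natE
    (fun t => if t.1.1 < 2 then 0 else min t.2.length (Nat.log t.1.1 t.1.2)) := by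
  let stE : ℕ × ℕ → List Bool := pairE natE natE
  -- context `(b, x)`, item a unit, state `(pow, r)`
  have hB : CodeFP (pairE (pairE natE natE) (pairE unitE stE)) natE (fun t => t.1.1) := (CodeFP.fst _ _).fst'
  have hX : CodeFP (pairE (pairE natE natE) (pairE unitE stE)) natE (fun t => t.1.2) := (CodeFP.fst _ _).snd'
  have hP : CodeFP (pairE (pairE natE natE) (pairE unitE stE)) natE (fun t => t.2.2.1) := (CodeFP.snd _ _).snd'.fst'
  have hR : CodeFP (pairE (pairE natE natE) (pairE unitE stE)) natE (fun t => t.2.2.2) := (CodeFP.snd _ _).snd'.snd'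
  have hPb : CodeFP (pairE (pairE natE natE) (pairE unitE stE)) natE (fun t => t.2.2.1 * t.1.1) := natMul.comp (hP.pair hB)
  have hstep : CodeFP (pairE (pairE natE natE) (pairE unitE stE)) stE (fun t => logStep t.1.1 t.1.2 t.2.2) :=
    ((natLe.comp (hPb.pair hX)).ite (hPb.pair (natAdd.comp (hR.pair (CodeFP.const _ 1)))) (CodeFP.snd _ _).snd').congr
      fun t => by simp only [logStep, decide_eq_true_eq]
  have hfold := CodeFP.foldl (σ := ℕ × ℕ) (α := Unit) (β := ℕ × ℕ) (eσ := pairE natE natE) (eα := unitE) (eβ := stE)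
      (step := fun s (_ : Unit) st => logStep s.1 s.2 st) (init := fun _ => ((1 : ℕ), (0 : ℕ))) hstep
      (CodeFP.const _ (1, 0)) (3 * X + 4) fun s l₁ l₂ => by
    obtain ⟨b, x⟩ := s
    -- the state stays `(pow, r)` with `pow ≤ max 1 x`, `r ≤ |l₁|`
    have hinv : ∀ l : List Unit, (l.foldl (fun st _ => logStep b x st) (1, 0)).1 ≤ max 1 x ∧
        (l.foldl (fun st _ => logStep b x st) (1, 0)).2 ≤ l.length := by
      intro l
      induction l using List.reverseRecOn with
      | nil => simp
      | append_singleton l a ih =>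
        rw [List.foldl_append, List.foldl_cons, List.foldl_nil, List.length_append, List.length_singleton, logStep]
        split_ifs with h
        · exact ⟨h.trans (le_max_right _ _), by dsimp only; omega⟩
        · exact ⟨ih.1, ih.2.trans (by omega)⟩
    obtain ⟨h1, h2⟩ := hinv l₁
    set v := l₁.foldl (fun st _ => logStep b x st) (1, 0)
    have e1 : (stE v).length = 2 * (natE v.1).length + 2 + (natE v.2).length := by
      simp only [stE, pairE_apply, length_boolPair]
    have e2 : (pairE (pairE natE natE) (rawE unitE) ((b, x), l₁ ++ l₂)).length =
        2 * (2 * (natE b).length + 2 + (natE x).length) + 2 + (rawE unitE (l₁ ++ l₂)).length := by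
      simp only [pairE_apply, length_boolPair]
    have h3 : (natE v.1).length ≤ (natE x).length + 1 := by
      refine (length_natE_mono h1).trans ?_
      rcases le_total 1 x with h | h
      · rw [max_eq_right h]; omega
      · rw [max_eq_left h]; exact Nat.succ_le_succ (Nat.zero_le _)
    have h4 : (natE v.2).length ≤ l₁.length := (length_natE_le _).trans h2
    have h5 := length_le_length_rawE unitE (l₁ ++ l₂)
    rw [List.length_append] at h5
    rw [e1, e2]
    simp only [eval_add, eval_mul, eval_X, eval_ofNat]
    omega
  have hlt : CodeFP (pairE (pairE natE natE) (rawE unitE)) bitE (fun t => decide (t.1.1 < 2)) :=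
    natLt.comp ((CodeFP.fst _ _).fst'.pair (CodeFP.const _ 2))
  refine (hlt.ite (CodeFP.const _ 0) hfold.snd').congr fun t => ?_
  show (if decide (t.1.1 < 2) = true then 0 else (t.2.foldl (fun b _ => logStep t.1.1 t.1.2 b) (1, 0)).2) =
    if t.1.1 < 2 then 0 else min t.2.length (Nat.log t.1.1 t.1.2)
  by_cases h2 : t.1.1 < 2
  · rw [if_pos (decide_eq_true h2), if_pos h2]
  · rw [if_neg (by simpa using h2), if_neg h2]
    have := foldl_logStep (by omega : 2 ≤ t.1.1) t.1.2 t.2 0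
    simp only [logState, Nat.zero_add, min_eq_left (Nat.zero_le _), pow_zero] at this
    rw [this]

/-- `log_b x ≤ |bin x|` for `b ≥ 2`. [folklore] -/
theorem log_le_length_natE {b : ℕ} (hb : 2 ≤ b) (x : ℕ) : Nat.log b x ≤ (natE x).length := by
  refine (Nat.log_anti_left (by norm_num : 1 < 2) hb).trans ?_
  rw [length_natE]
  rcases Nat.eq_zero_or_pos x with rfl | hx
  · simp
  · exact (Nat.lt_size.2 (Nat.pow_log_le_self 2 hx.ne')).le

/-- **Logarithm to a computed base**: `(b, x) ↦ log_b x`. [cite: AroraBarakCC2009, §1.3] -/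
theorem natLogC : CodeFP (pairE natE natE) natE (fun t => Nat.log t.1 t.2) := by
  have hbud : CodeFP (pairE natE natE) (rawE unitE) (fun t => List.replicate (natE t.2).length ()) :=
    replicateUnit.comp (strLength.comp (strOfNat.comp (CodeFP.snd _ _)))
  refine (natLogMin.comp ((CodeFP.id _).pair hbud)).congr fun t => ?_
  show (if t.1 < 2 then 0 else min (List.replicate (natE t.2).length ()).length (Nat.log t.1 t.2)) = Nat.log t.1 t.2
  split_ifs with h
  · exact (Nat.log_of_left_le_one (by omega) _).symm
  · rw [List.length_replicate, min_eq_right (log_le_length_natE (by omega) _)]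

/-! ### The parameters off `1ⁿ` -/

variable (M : TM2ComputableAux Bool Bool) (T : ℕ → ℕ) (hTc : CodeFP unE natE T)

local notation "d" => dM M

/-- `n` in binary. [folklore] -/
theorem nC : CodeFP unE natE (fun n => n) := natOfUn

/-- `hN`. [folklore] -/
theorem hNC : CodeFP unE natE (hN M) :=
  (natAdd.comp ((natAdd.comp ((natMul.comp ((CodeFP.const _ 16).pair (nC))).pair (CodeFP.const _ (8 * cQ M)))).pair
    (CodeFP.const _ 8))).congr fun n => by unfold hN; ring

include hTc in
/-- `S1N`. [folklore] -/
theorem S1NC : CodeFP unE natE (S1N M T) :=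
  (natAdd.comp ((natAdd.comp ((natAdd.comp ((natMul.comp ((CodeFP.const _ 2).pair nC)).pair (CodeFP.const _ 2))).pair
    (natMul.comp ((CodeFP.const _ d).pair hTc)))).pair (CodeFP.const _ (3 * d)))).congr fun n => by
    unfold S1N S1 NN; ring

include hTc in
/-- `ktN`. [folklore] -/
theorem ktNC : CodeFP unE natE (ktN M T) :=
  (natAdd.comp ((natLogC.comp ((hNC M).pair hTc)).pair (CodeFP.const _ 1))).congr fun n => by unfold ktN; rfl

include hTc in
/-- `kJN`. [folklore] -/
theorem kJNC : CodeFP unE natE (kJN M T) :=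
  (natAdd.comp ((natLogC.comp ((hNC M).pair (S1NC M T hTc))).pair (CodeFP.const _ 1))).congr fun n => by unfold kJN; rfl

include hTc in
/-- `mN`. [folklore] -/
theorem mNC : CodeFP unE natE (mN M T) :=
  (natAdd.comp ((natAdd.comp ((ktNC M T hTc).pair (kJNC M T hTc))).pair (CodeFP.const _ 1))).congr fun n => by unfold mN mPt LN; rfl

include hTc in
/-- `KN`. [folklore] -/
theorem KNC : CodeFP unE natE (KN M T) :=
  (natAdd.comp ((natAdd.comp ((ktNC M T hTc).pair (ktNC M T hTc))).pair (natMul.comp ((CodeFP.const _ (2 * d + 1)).pair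
    (kJNC M T hTc))))).congr fun n => by unfold KN KIdx LN; rfl

include hTc in
/-- `dN`. [folklore] -/
theorem dNC : CodeFP unE natE (dN M T) :=
  (natMul.comp ((mNC M T hTc).pair (natSub.comp ((hNC M).pair (CodeFP.const _ 1))))).congr fun n => by unfold dN; rfl

include hTc in
/-- `degBound M (LN n)`. [folklore] -/
theorem degBoundC : CodeFP unE natE (fun n => degBound M (LN M T n)) :=
  (natAdd.comp ((natAdd.comp ((natMul.comp ((natAdd.comp ((natMul.comp ((CodeFP.const _ 3).pair (ktNC M T hTc))).pair
    (natMul.comp ((CodeFP.const _ (4 * d + 2)).pair (kJNC M T hTc))))).pair (natSub.comp ((hNC M).pair (CodeFP.const _ 1))))).pair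
    (CodeFP.const _ (3 * d + 3)))).pair (CodeFP.const _ (Nat.card (Val M.tm))))).congr fun n => by unfold degBound LN; rfl

include hTc in
/-- `DN`. [folklore] -/
theorem DNC : CodeFP unE natE (DN M T) :=
  (natAdd.comp ((natMul.comp ((degBoundC M T hTc).pair (dNC M T hTc))).pair (natSub.comp ((hNC M).pair (CodeFP.const _ 1))))).congr
    fun n => by unfold DN; rfl

include hTc in
/-- `TtN`. [folklore] -/
theorem TtNC : CodeFP unE natE (TtN M T) :=
  (natMul.comp ((CodeFP.const _ 4).pair (natMul.comp ((natAdd.comp ((dNC M T hTc).pair (CodeFP.const _ 1))).pair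
    (natAdd.comp ((natMul.comp ((CodeFP.const _ 2).pair (dNC M T hTc))).pair (CodeFP.const _ 5))))))).congr fun n => by unfold TtN; rfl

/-- The number of `n`-families (a constant of the machine, for `P = 0`). [folklore] -/
def cN : ℕ := (nFams (F := ℚ) M ⟨2, 1, 1⟩ 0 0 0).length

/-- `NN' n = 2 n + cN`. [folklore] -/
theorem NN'_eq (n : ℕ) : NN' M T n = 2 * n + cN M := by
  unfold NN' cN
  rw [length_nFams_eq M (F := ℚ) (F' := ℚ) (P := 0) (LN M T n) ⟨2, 1, 1⟩ n 0 (T n) 0]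

/-- `NN'`. [folklore] -/
theorem NN'C : CodeFP unE natE (NN' M T) :=
  (natAdd.comp ((natMul.comp ((CodeFP.const _ 2).pair nC)).pair (CodeFP.const _ (cN M)))).congr fun n => (NN'_eq M T n).symm

include hTc in
/-- `BN`. [folklore] -/
theorem BNC : CodeFP unE natE (BN M T) := by
  have hK := KNC M T hTc
  have hh1 : CodeFP unE natE (fun n => hN M n - 1) := natSub.comp ((hNC M).pair (CodeFP.const _ 1))
  refine (natAdd.comp ((natMul.comp ((CodeFP.const _ 16).pair (natAdd.comp ((natAdd.comp ((natAdd.comp ((natAdd.comp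
    ((natMul.comp (hK.pair (DNC M T hTc))).pair (natMul.comp (hK.pair hh1)))).pair (NN'C M T))).pair (dNC M T hTc))).pair
    (hNC M))))).pair (CodeFP.const _ (Nat.card (Val M.tm))))).congr fun n => ?_
  unfold BN; rfl

/-! ### The polynomial size of `BN` (sizing the unary budget of the prime search) -/

section Size

variable (cT : ℕ) (hTb : ∀ n, T n ≤ 2 ^ (cT * n + cT))

/-- The master constant of the size bounds. [folklore] -/
def c0 : ℕ := cT + 4 * dM M + 8 * cQ M + Nat.card (Val M.tm) + cN M + 20

/-- The master linear bound `U n = c₀ (n + 2)`. [folklore] -/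
def UU (n : ℕ) : ℕ := c0 M cT * (n + 2)

omit hTc in
/-- `c₀ ≤ U n` and `1 ≤ U n`. [folklore] -/
theorem c0_le_UU (n : ℕ) : c0 M cT ≤ UU M cT n ∧ 1 ≤ UU M cT n := by
  unfold UU
  have : 1 ≤ c0 M cT := by unfold c0; omega
  constructor <;> nlinarith

omit hTc in
/-- `h ≤ U`. [folklore] -/
theorem hN_le_UU (n : ℕ) : hN M n ≤ UU M cT n := by
  unfold hN UU c0; nlinarith

include hTb in
omit hTc in
/-- `log₂ T n ≤ c_T n + c_T`. [folklore] -/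
theorem log_T_le (n : ℕ) : Nat.log 2 (T n) ≤ cT * n + cT := by
  calc Nat.log 2 (T n) ≤ Nat.log 2 (2 ^ (cT * n + cT)) := Nat.log_mono_right (hTb n)
    _ = cT * n + cT := Nat.log_pow (by norm_num) _

include hTb in
omit hTc in
/-- `kt ≤ U`. [folklore] -/
theorem ktN_le_UU (n : ℕ) : ktN M T n ≤ UU M cT n := by
  have h1 : Nat.log (hN M n) (T n) ≤ Nat.log 2 (T n) := Nat.log_anti_left (by norm_num) (two_le_hN M n)
  have h2 := log_T_le T cT hTb n
  unfold ktN UU c0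
  nlinarith

include hTb in
omit hTc in
/-- `log₂ S₁ ≤ 2n + 2 + 4d + c_T n + c_T`. [folklore] -/
theorem log_S1N_le (n : ℕ) : Nat.log 2 (S1N M T n) ≤ 2 * n + 2 + 4 * d + (cT * n + cT) := by
  have hT := hTb n
  have hS : S1N M T n ≤ 2 ^ (2 * n + 2 + 4 * d + (cT * n + cT)) := by
    unfold S1N S1 NN
    have h1 : 2 * n + 2 + 0 + d * T n + 3 * d ≤ (2 * n + 2 + 4 * d) * 2 ^ (cT * n + cT) := by
      have : 1 ≤ 2 ^ (cT * n + cT) := Nat.one_le_two_pow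
      nlinarith
    refine h1.trans ?_
    calc (2 * n + 2 + 4 * d) * 2 ^ (cT * n + cT) ≤ 2 ^ (2 * n + 2 + 4 * d) * 2 ^ (cT * n + cT) :=
          Nat.mul_le_mul_right _ (Nat.lt_two_pow_self).le
      _ = 2 ^ (2 * n + 2 + 4 * d + (cT * n + cT)) := (pow_add 2 _ _).symm
  calc Nat.log 2 (S1N M T n) ≤ Nat.log 2 (2 ^ (2 * n + 2 + 4 * d + (cT * n + cT))) := Nat.log_mono_right hS
    _ = _ := Nat.log_pow (by norm_num) _

include hTb in
omit hTc in
/-- `kJ ≤ U`. [folklore] -/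
theorem kJN_le_UU (n : ℕ) : kJN M T n ≤ UU M cT n := by
  have h1 : Nat.log (hN M n) (S1N M T n) ≤ Nat.log 2 (S1N M T n) := Nat.log_anti_left (by norm_num) (two_le_hN M n)
  have h2 := log_S1N_le M T cT hTb n
  unfold kJN UU c0
  nlinarith

omit hTc in
/-- Below `U`, below every power of `U`. [folklore] -/
theorem le_UU_pow {n a j : ℕ} (ha : a ≤ UU M cT n) (hj : 1 ≤ j) : a ≤ UU M cT n ^ j :=
  ha.trans (by simpa using Nat.pow_le_pow_right (c0_le_UU M cT n).2 hj)

include hTb in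
omit hTc in
/-- **The polynomial size of the search window**: `2 BN n + 2 ≤ 420 · U(n)⁷`, `U(n) = c₀ (n+2)`.
[cite: BFLS1991, §5 (parameters polynomial in the input length)] -/
theorem BN_le (n : ℕ) : 2 * BN M T n + 2 ≤ 420 * UU M cT n ^ 7 := by
  obtain ⟨hcU, hU1⟩ := c0_le_UU M cT n
  set U := UU M cT n with hUdef
  have hc0 : 4 * d + 5 ≤ U ∧ 2 * d + 3 ≤ U ∧ Nat.card (Val M.tm) + 3 * d + 3 ≤ U ∧ 2 * n + cN M ≤ U := by
    have : c0 M cT = cT + 4 * dM M + 8 * cQ M + Nat.card (Val M.tm) + cN M + 20 := rfl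
    refine ⟨by omega, by omega, by omega, ?_⟩
    rw [hUdef]; unfold UU c0; nlinarith
  have hh := hN_le_UU M cT n
  have hkt := ktN_le_UU M T cT hTb n
  have hkJ := kJN_le_UU M T cT hTb n
  rw [← hUdef] at hh hkt hkJ
  have hm : mN M T n ≤ 3 * U := by unfold mN mPt LN; dsimp only; omega
  have hK : KN M T n ≤ U * U := by
    unfold KN KIdx LN; dsimp only
    calc ktN M T n + ktN M T n + (2 * d + 1) * kJN M T n ≤ U + U + (2 * d + 1) * U :=
          Nat.add_le_add (by omega) (Nat.mul_le_mul_left _ hkJ)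
      _ = (2 * d + 3) * U := by ring
      _ ≤ U * U := Nat.mul_le_mul_right _ hc0.2.1
  have hdN : dN M T n ≤ 3 * U * U := by
    unfold dN
    exact Nat.mul_le_mul hm (by omega)
  have hA : 3 * ktN M T n + (4 * d + 2) * kJN M T n ≤ (4 * d + 5) * U := by
    calc 3 * ktN M T n + (4 * d + 2) * kJN M T n ≤ 3 * U + (4 * d + 2) * U :=
          Nat.add_le_add (by omega) (Nat.mul_le_mul_left _ hkJ)
      _ = (4 * d + 5) * U := by ring
  have hdeg : degBound M (LN M T n) ≤ 2 * (U * U * U) := by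
    unfold degBound LN; dsimp only
    have h1 : (3 * ktN M T n + (4 * d + 2) * kJN M T n) * (hN M n - 1) ≤ ((4 * d + 5) * U) * U := Nat.mul_le_mul hA (by omega)
    have h2 : ((4 * d + 5) * U) * U ≤ U * U * U := Nat.mul_le_mul_right _ (Nat.mul_le_mul_right _ hc0.1)
    have h4 : U ≤ U * U * U := by nlinarith
    linarith
  have hprod : degBound M (LN M T n) * dN M T n ≤ 2 * (U * U * U) * (3 * U * U) := Nat.mul_le_mul hdeg hdN
  have hU5 : U ≤ U ^ 5 := le_UU_pow M cT (n := n) (by rw [← hUdef]) (by norm_num)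
  have hD : DN M T n ≤ 7 * U ^ 5 := by
    unfold DN
    have e : 2 * (U * U * U) * (3 * U * U) + U ^ 5 = 7 * U ^ 5 := by ring
    rw [← e]
    exact Nat.add_le_add hprod (le_trans (by omega) hU5)
  have hNN : NN' M T n ≤ U := by rw [NN'_eq]; exact hc0.2.2.2
  have hB : BN M T n ≤ 209 * U ^ 7 := by
    unfold BN
    have h7 : ∀ a, a ≤ U → a ≤ U ^ 7 := fun a ha => le_UU_pow M cT (n := n) (by rwa [← hUdef]) (by norm_num)
    calc 16 * (KN M T n * DN M T n + KN M T n * (hN M n - 1) + NN' M T n + dN M T n + hN M n) + Nat.card (Val M.tm)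
        ≤ 16 * (U * U * (7 * U ^ 5) + U * U * U + U ^ 7 + 3 * U * U + U ^ 7) + U ^ 7 := by
          refine Nat.add_le_add (Nat.mul_le_mul_left _ ?_) (h7 _ (by omega))
          exact Nat.add_le_add (Nat.add_le_add (Nat.add_le_add (Nat.add_le_add (Nat.mul_le_mul hK hD)
            (Nat.mul_le_mul hK (by omega))) (h7 _ hNN)) hdN) (h7 _ hh)
      _ ≤ 16 * (U * U * (7 * U ^ 5) + U ^ 7 + U ^ 7 + 3 * U ^ 7 + U ^ 7) + U ^ 7 := by
          have h3 : U * U * U ≤ U ^ 7 := by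
            calc U * U * U = U ^ 3 := by ring
              _ ≤ U ^ 7 := Nat.pow_le_pow_right hU1 (by norm_num)
          have h2 : 3 * U * U ≤ 3 * U ^ 7 := by
            calc 3 * U * U = 3 * U ^ 2 := by ring
              _ ≤ 3 * U ^ 7 := Nat.mul_le_mul_left _ (Nat.pow_le_pow_right hU1 (by norm_num))
          nlinarith
      _ = 209 * U ^ 7 := by ring
  have hu1 : 1 ≤ U ^ 7 := Nat.one_le_pow _ _ hU1
  omega

end Size

/-! ### The prime and the coin parameters off `1ⁿ` -/

section Prime

variable (cT : ℕ) (hTb : ∀ n, T n ≤ 2 ^ (cT * n + cT))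

/-- The unary budget `420 · U(n)⁷`. [folklore] -/
theorem budgetC : CodeFP unE unE (fun n => 420 * UU M cT n ^ 7) := by
  have hU : CodeFP unE unE (UU M cT) :=
    ((unMulConst (c0 M cT)).comp (unSucc.comp unSucc)).congr fun n => by unfold UU; ring
  exact ((unMulConst 420).comp (((ulength unitE).comp (unitsPow 7)).comp hU)).congr fun n => by simp

/-- **`pN n` is the least prime above `BN n`** (`leastPrimeGt`, `CodeFPFieldSetup.lean`). [folklore] -/
theorem pN_eq_leastPrimeGt (n : ℕ) : pN M T n = leastPrimeGt (BN M T n) := by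
  classical
  refine le_antisymm ?_ (leastPrimeGt_min (pN_prime M T n) (BN_lt_pN M T n))
  unfold pN
  exact Nat.find_min' _ ⟨(leastPrimeGt_spec _).2, (leastPrimeGt_spec _).1⟩

include hTc hTb in
/-- **The prime `pN n` off `1ⁿ`**: the bound `BN n` is made unary against the budget `420 · U(n)⁷`
(`BN_le`), then `leastPrimeGtCode`. [cite: AroraBarakCC2009, §1.3, §A.2] -/
theorem pNC : CodeFP unE natE (pN M T) := by
  have hBun : CodeFP unE unE (fun n => min (BN M T n) (420 * UU M cT n ^ 7)) :=
    unOfNatMin.comp ((budgetC M cT).pair (BNC M T hTc))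
  refine (leastPrimeGtCode.comp hBun).congr fun n => ?_
  have hsize := BN_le M T cT hTb n
  show leastPrimeGt (min (BN M T n) (420 * UU M cT n ^ 7)) = pN M T n
  rw [min_eq_left (by omega), pN_eq_leastPrimeGt]

include hTc hTb in
/-- `b0 n = ⌊log₂ p⌋ + 1`. [folklore] -/
theorem b0C : CodeFP unE natE (b0 M T) :=
  (natAdd.comp ((natLogC.comp ((CodeFP.const _ 2).pair (pNC M T hTc cT hTb))).pair (CodeFP.const _ 1))).congr fun n => by
    unfold b0; rfl

/-- **The tape length in closed form**: `kF n = K + 1 + K + Tt · 2m + (2n + c_Q) m`. [folklore] -/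
theorem kF_formula (n : ℕ) :
    kF M T n = KN M T n + (1 + (KN M T n + (TtN M T n * (mN M T n + mN M T n) + (2 * n + cQ M) * mN M T n))) := by
  unfold kF nTape
  rw [nQry_CN, List.length_replicate, sum_arity_nFams_zero]

include hTc in
/-- `kF n` off `1ⁿ`. [folklore] -/
theorem kFC : CodeFP unE natE (kF M T) := by
  have hK := KNC M T hTc
  have hm := mNC M T hTc
  refine (natAdd.comp (hK.pair (natAdd.comp ((CodeFP.const _ 1).pair (natAdd.comp (hK.pair (natAdd.comp
    ((natMul.comp ((TtNC M T hTc).pair (natAdd.comp (hm.pair hm)))).pair (natMul.comp ((natAdd.comp ((natMul.comp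
    ((CodeFP.const _ 2).pair nC)).pair (CodeFP.const _ (cQ M)))).pair hm)))))))))).congr fun n => (kF_formula M T n).symm

include hTc hTb in
/-- `bN n` off `1ⁿ`. [folklore] -/
theorem bNC : CodeFP unE natE (bN M T) :=
  (natAdd.comp ((natAdd.comp ((natLogC.comp ((CodeFP.const _ 2).pair (pNC M T hTc cT hTb))).pair (CodeFP.const _ 1))).pair
    (natAdd.comp ((natLogC.comp ((CodeFP.const _ 2).pair (kFC M T hTc))).pair (CodeFP.const _ 5))))).congr fun n => by unfold bN; rfl

include hTc hTb in
/-- **The coin count `coinsN n` off `1ⁿ`** (binary). [folklore] -/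
theorem coinsNC : CodeFP unE natE (coinsN M T) :=
  (natMul.comp ((kFC M T hTc).pair (bNC M T hTc cT hTb))).congr fun n => by unfold coinsN; rfl

end Prime

end ScaledPCP

end Literature.Computability.Complexity

end
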